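import Literature.NumberTheory.LFunctions.ConreyIwaniec2002CircleMethodDefs
import Literature.Analysis.FunctionSpaces.BesselJAnalyticProofs
import HarnessLib

/-!
# Conrey–Iwaniec (2002), §4 (4.22)–(4.23): an explicit non-oscillatory amplitude `W` with
# `J₀(u) = Re(e^{iu}W(u))` — derivatives and pointwise brackets

B. Conrey, H. Iwaniec, *Spacing of zeros of Hecke `L`-functions and the class number problem*,
Acta Arith. 103 (2002) 259–312, §4 [held text `paper:arxiv-math_0111012`, p0012:L40–57]: "the
Bessel function can be written as `J_{k−1}(2πy) = W(y)e(y) + W̄(y)e(−y)` where `W(y)` is a smooth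
non-oscillatory function whose derivatives satisfy `y^νW^{(ν)}(y) ≪ k²y^{−1/2}` if `ν = 0,1,2`".
This is the content of the tree interface `ConreyIwaniec2002.BesselJZeroAmplitude C_W`
(`ConreyIwaniec2002CircleMethodDefs.lean`), the registered stub S3c1 `stub_bessel_amplitude` of
SKELETON S3 (cell `landau-siegel/ls-inputs`, line `theta-circle-method`).

This file (part 1 of 2) treats the ELEMENTARY witness
`W(u) = e^{−iu}(J₀(u) + iJ₁(u) − iρ(u)J₀(u))`, `ρ(u) = u/(2(u²+1))` (`= 1/(2u) + O(u⁻³)`; no Hankel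
functions, no piecewise gluing): since `Re(e^{iu}·e^{−iu}(J₀ + iF)) = J₀` for every real `F`, only
the symbol bounds need work. From the tree's `J₀' = −J₁` and `(uJ₁)' = uJ₀`
(`hasDerivAt_besselJ_zero_holds`, `hasDerivAt_besselJ_succ_of_ne_zero`):
* `hasDerivAt_amplitude`: `W' = e^{−iu}[−(ρ + iρ')J₀ + i(ρ − u⁻¹)J₁]` (`u ≠ 0`);
* `hasDerivAt_amplitude_deriv`:
  `W'' = e^{−iu}[(−2ρ' − iρ'' + i(2ρ − u⁻¹))J₀ + ((2ρ − u⁻¹) + i(2ρ' + 2u⁻² − ρu⁻¹))J₁]`;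
* `norm_bracket₀_le`, `norm_bracket₁_le`, `norm_bracket₂_le`: pointwise bounds of the three brackets
  in terms of `|J₀(u)|`, `|J₁(u)|` and rational functions of `u` (`2ρ − u⁻¹ = −1/(u(u²+1))`,
  `|ρ'| ≤ 1/(2(u²+1))`, `|ρ''| ≤ 3u/(u²+1)²`).
Part 2 (`ConreyIwaniec2002BesselAmplitude.lean`) combines them with `|J_n(u)| ≤ Cu^{−1/2}` (`u ≥ 2`)
and `|J₀| ≤ 1`, `|J₁(u)| ≤ u/2` (`u ≤ 2`) into `∃ C_W > 0, BesselJZeroAmplitude C_W`.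

## References

* [ConreyIwaniec2002] B. Conrey, H. Iwaniec, Acta Arith. 103 (2002) 259–312, arXiv:math/0111012:
  §4 (4.22)–(4.23).
* [Watson1944] G. N. Watson, *A Treatise on the Theory of Bessel Functions*, 2nd ed. (1944), §2.12
  (`J₀' = −J₁`, `(xJ₁)' = xJ₀`), §7.21.
-/

noncomputable section

open Complex Set Real

namespace Literature.NumberTheory.LFunctions

namespace ConreyIwaniec2002

namespace BesselAmplitude

open Literature.Analysis.FunctionSpaces

/-! ### The correction factor `ρ(u) = u/(2(u²+1))` and its derivatives -/

/-- `d/du [u/(2(u²+1))] = (1 − u²)/(2(u²+1)²)`. [cite: ConreyIwaniec2002, §4 (4.22)–(4.23)] -/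
theorem hasDerivAt_rho (u : ℝ) :
    HasDerivAt (fun v : ℝ ↦ v / (2 * (v ^ 2 + 1))) ((1 - u ^ 2) / (2 * (u ^ 2 + 1) ^ 2)) u := by
  have h1 : HasDerivAt (fun v : ℝ ↦ 2 * (v ^ 2 + 1)) (2 * (2 * u)) u := by
    have := ((hasDerivAt_pow 2 u).add_const 1).const_mul 2
    simpa using this
  have h0 : (2 : ℝ) * (u ^ 2 + 1) ≠ 0 := by positivity
  have h := (hasDerivAt_id u).div h1 h0
  refine h.congr_deriv ?_
  simp only [id]
  field_simp
  ring

/-- `d/du [(1 − u²)/(2(u²+1)²)] = u(u² − 3)/(u²+1)³`. [cite: ConreyIwaniec2002, §4 (4.22)–(4.23)] -/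
theorem hasDerivAt_rho' (u : ℝ) :
    HasDerivAt (fun v : ℝ ↦ (1 - v ^ 2) / (2 * (v ^ 2 + 1) ^ 2))
      (u * (u ^ 2 - 3) / (u ^ 2 + 1) ^ 3) u := by
  have hnum : HasDerivAt (fun v : ℝ ↦ 1 - v ^ 2) (-(2 * u)) u := by
    have := (hasDerivAt_pow 2 u).const_sub 1
    simpa using this
  have hden : HasDerivAt (fun v : ℝ ↦ 2 * (v ^ 2 + 1) ^ 2) (2 * (2 * (u ^ 2 + 1) * (2 * u))) u := by
    have h1 : HasDerivAt (fun v : ℝ ↦ v ^ 2 + 1) (2 * u) u := by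
      simpa using (hasDerivAt_pow 2 u).add_const 1
    have := (h1.pow 2).const_mul 2
    simpa using this
  have h0 : (2 : ℝ) * (u ^ 2 + 1) ^ 2 ≠ 0 := by positivity
  have h := hnum.div hden h0
  refine h.congr_deriv ?_
  have h1 : (u ^ 2 + 1) ≠ 0 := by positivity
  field_simp
  ring

/-! ### Elementary inequalities for `ρ`, `ρ'`, `ρ''` -/

/-- `|ρ(u)| ≤ 1/4` (`u/(u²+1) ≤ 1/2`). [cite: ConreyIwaniec2002, §4 (4.22)–(4.23)] -/
theorem abs_rho_le_quarter (u : ℝ) : |u / (2 * (u ^ 2 + 1))| ≤ 1 / 4 := by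
  rw [abs_div, abs_of_pos (by positivity : (0:ℝ) < 2 * (u ^ 2 + 1)), div_le_iff₀ (by positivity)]
  nlinarith [abs_nonneg u, sq_abs u, sq_nonneg (|u| - 1)]

/-- `|ρ(u)| ≤ 1/(2u)` for `u > 0`. [cite: ConreyIwaniec2002, §4 (4.22)–(4.23)] -/
theorem abs_rho_le_inv {u : ℝ} (hu : 0 < u) : |u / (2 * (u ^ 2 + 1))| ≤ 1 / (2 * u) := by
  rw [abs_of_nonneg (by positivity), div_le_div_iff₀ (by positivity) (by positivity)]
  nlinarith

/-- `|ρ'(u)| ≤ 1/(2(u²+1))`. [cite: ConreyIwaniec2002, §4 (4.22)–(4.23)] -/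
theorem abs_rho'_le (u : ℝ) : |(1 - u ^ 2) / (2 * (u ^ 2 + 1) ^ 2)| ≤ 1 / (2 * (u ^ 2 + 1)) := by
  rw [abs_div, abs_of_pos (by positivity : (0:ℝ) < 2 * (u ^ 2 + 1) ^ 2),
    div_le_div_iff₀ (by positivity) (by positivity)]
  have : |1 - u ^ 2| ≤ u ^ 2 + 1 := by
    rw [abs_le]; constructor <;> nlinarith [sq_nonneg u]
  nlinarith [sq_nonneg u]

/-- `|ρ''(u)| ≤ 3u/(u²+1)²` for `u ≥ 0`. [cite: ConreyIwaniec2002, §4 (4.22)–(4.23)] -/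
theorem abs_rho''_le (u : ℝ) (hu : 0 ≤ u) :
    |u * (u ^ 2 - 3) / (u ^ 2 + 1) ^ 3| ≤ 3 * u / (u ^ 2 + 1) ^ 2 := by
  rw [abs_div, abs_of_pos (by positivity : (0:ℝ) < (u ^ 2 + 1) ^ 3),
    div_le_div_iff₀ (by positivity) (by positivity), abs_mul, abs_of_nonneg hu]
  have : |u ^ 2 - 3| ≤ 3 * (u ^ 2 + 1) := by
    rw [abs_le]; constructor <;> nlinarith [sq_nonneg u]
  have h2 : 0 ≤ u * (u ^ 2 + 1) ^ 2 := by positivity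
  calc u * |u ^ 2 - 3| * (u ^ 2 + 1) ^ 2 = (u * (u ^ 2 + 1) ^ 2) * |u ^ 2 - 3| := by ring
    _ ≤ (u * (u ^ 2 + 1) ^ 2) * (3 * (u ^ 2 + 1)) := mul_le_mul_of_nonneg_left this h2
    _ = 3 * u * (u ^ 2 + 1) ^ 3 := by ring

/-- `2ρ(u) − 1/u = −1/(u(u²+1))`: the correction `ρ` matches `1/(2u)` to second order. [cite: ConreyIwaniec2002, §4 (4.22)–(4.23)] -/
theorem two_rho_sub_inv {u : ℝ} (hu : u ≠ 0) :
    2 * (u / (2 * (u ^ 2 + 1))) - u⁻¹ = -(u * (u ^ 2 + 1))⁻¹ := by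
  have : u ^ 2 + 1 ≠ 0 := by positivity
  field_simp
  ring

/-- `|ρ(u) − 1/u| ≤ 1/u` for `u > 0`. [cite: ConreyIwaniec2002, §4 (4.22)–(4.23)] -/
theorem abs_rho_sub_inv_le {u : ℝ} (hu : 0 < u) : |u / (2 * (u ^ 2 + 1)) - u⁻¹| ≤ u⁻¹ := by
  have h : u / (2 * (u ^ 2 + 1)) - u⁻¹ = -((u ^ 2 + 2) / (2 * u * (u ^ 2 + 1))) := by
    field_simp
    ring
  rw [h, abs_neg, abs_of_pos (by positivity), div_le_iff₀ (by positivity), inv_mul_eq_div,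
    le_div_iff₀ hu]
  nlinarith [sq_nonneg u]

/-! ### The amplitude `W(u) = e^{−iu}(J₀(u) + iJ₁(u) − iρ(u)J₀(u))` and its derivatives -/

/-- Algebra of the first derivative. [cite: ConreyIwaniec2002, §4 (4.22)–(4.23)] -/
theorem deriv_identity₁ (E u r r' j0 j1 : ℂ) (hu : u ≠ 0) :
    E * -I * (j0 + I * j1 - I * r * j0) +
        E * (-j1 + I * ((u * j0 - j1) / u) - (I * r' * j0 + I * r * -j1)) =
      E * (-(r + I * r') * j0 + I * (r - u⁻¹) * j1) := by
  field_simp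
  ring_nf
  simp only [Complex.I_sq]
  ring

/-- Algebra of the second derivative. [cite: ConreyIwaniec2002, §4 (4.22)–(4.23)] -/
theorem deriv_identity₂ (E U r r' r'' j0 j1 : ℂ) (hU : U ≠ 0) :
    E * -I * (-(r + I * r') * j0 + I * (r - U⁻¹) * j1) +
      E * (-(r' + I * r'') * j0 + -(r + I * r') * -j1 +
        (I * (r' - -(U ^ 2)⁻¹) * j1 + I * (r - U⁻¹) * ((U * j0 - j1) / U))) =
    E * ((-2 * r' - I * r'' + I * (2 * r - U⁻¹)) * j0 +
      (2 * r - U⁻¹ + I * (2 * r' + 2 * U⁻¹ ^ 2 - r * U⁻¹)) * j1) := by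
  field_simp
  ring_nf
  simp only [Complex.I_sq]
  ring

/-- `W' = e^{−iu}[−(ρ + iρ')J₀ + i(ρ − 1/u)J₁]` for `u ≠ 0`. [cite: ConreyIwaniec2002, §4 (4.22)–(4.23)] -/
theorem hasDerivAt_amplitude {u : ℝ} (hu : u ≠ 0) :
    HasDerivAt
      (fun v : ℝ ↦ exp (-I * v) * ((besselJ 0 v : ℂ) + I * (besselJ 1 v : ℂ) -
        I * ((v / (2 * (v ^ 2 + 1)) : ℝ) : ℂ) * (besselJ 0 v : ℂ)))
      (exp (-I * u) * (-(((u / (2 * (u ^ 2 + 1)) : ℝ) : ℂ) + I * (((1 - u ^ 2) / (2 * (u ^ 2 + 1) ^ 2) : ℝ) : ℂ)) * (besselJ 0 u : ℂ) +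
        I * (((u / (2 * (u ^ 2 + 1)) : ℝ) : ℂ) - ((u⁻¹ : ℝ) : ℂ)) * (besselJ 1 u : ℂ))) u := by
  have hE : HasDerivAt (fun v : ℝ ↦ exp (-I * v)) (exp (-I * u) * -I) u := by
    have h1 : HasDerivAt (fun v : ℝ ↦ -I * (v : ℂ)) (-I * 1) u :=
      ((hasDerivAt_id u).ofReal_comp).const_mul (-I)
    rw [mul_one] at h1
    exact h1.cexp
  have hJ0 : HasDerivAt (fun v : ℝ ↦ (besselJ 0 v : ℂ)) (((-besselJ 1 u : ℝ) : ℂ)) u :=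
    (hasDerivAt_besselJ_zero_holds u).ofReal_comp
  have hJ1r := hasDerivAt_besselJ_succ_of_ne_zero 0 hu
  simp only [zero_add, Nat.cast_zero, one_mul] at hJ1r
  have hJ1 : HasDerivAt (fun v : ℝ ↦ (besselJ 1 v : ℂ))
      ((((u * besselJ 0 u - besselJ 1 u) / u : ℝ) : ℂ)) u := hJ1r.ofReal_comp
  have hρ : HasDerivAt (fun v : ℝ ↦ (((v / (2 * (v ^ 2 + 1))) : ℝ) : ℂ))
      ((((1 - u ^ 2) / (2 * (u ^ 2 + 1) ^ 2) : ℝ) : ℂ)) u := (hasDerivAt_rho u).ofReal_comp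
  have hB := (hJ0.add (hJ1.const_mul I)).sub ((hρ.const_mul I).mul hJ0)
  have hW := hE.mul hB
  refine hW.congr_deriv ?_
  simp only [Pi.add_apply, Pi.sub_apply, Pi.mul_apply]
  have huC : (u : ℂ) ≠ 0 := by exact_mod_cast hu
  have key := deriv_identity₁ (exp (-I * u)) (u : ℂ) ((u / (2 * (u ^ 2 + 1)) : ℝ))
    (((1 - u ^ 2) / (2 * (u ^ 2 + 1) ^ 2) : ℝ)) (besselJ 0 u) (besselJ 1 u) huC
  push_cast at key ⊢
  simpa using key

/-- `W'' = e^{−iu}[(−2ρ' − iρ'' + i(2ρ − u⁻¹))J₀ + ((2ρ − u⁻¹) + i(2ρ' + 2u⁻² − ρu⁻¹))J₁]` for `u ≠ 0`. [cite: ConreyIwaniec2002, §4 (4.22)–(4.23)] -/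
theorem hasDerivAt_amplitude_deriv {u : ℝ} (hu : u ≠ 0) :
    HasDerivAt
      (fun v : ℝ ↦ exp (-I * v) * (-(((v / (2 * (v ^ 2 + 1)) : ℝ) : ℂ) + I * (((1 - v ^ 2) / (2 * (v ^ 2 + 1) ^ 2) : ℝ) : ℂ)) * (besselJ 0 v : ℂ) +
        I * (((v / (2 * (v ^ 2 + 1)) : ℝ) : ℂ) - ((v⁻¹ : ℝ) : ℂ)) * (besselJ 1 v : ℂ)))
      (exp (-I * u) * ((-2 * (((1 - u ^ 2) / (2 * (u ^ 2 + 1) ^ 2) : ℝ) : ℂ) - I * ((u * (u ^ 2 - 3) / (u ^ 2 + 1) ^ 3 : ℝ) : ℂ) + I * (2 * ((u / (2 * (u ^ 2 + 1)) : ℝ) : ℂ) - ((u⁻¹ : ℝ) : ℂ))) * (besselJ 0 u : ℂ) +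
        ((2 * ((u / (2 * (u ^ 2 + 1)) : ℝ) : ℂ) - ((u⁻¹ : ℝ) : ℂ)) + I * (2 * (((1 - u ^ 2) / (2 * (u ^ 2 + 1) ^ 2) : ℝ) : ℂ) + 2 * ((u⁻¹ : ℝ) : ℂ) ^ 2 - ((u / (2 * (u ^ 2 + 1)) : ℝ) : ℂ) * ((u⁻¹ : ℝ) : ℂ))) * (besselJ 1 u : ℂ))) u := by
  have hE : HasDerivAt (fun v : ℝ ↦ exp (-I * v)) (exp (-I * u) * -I) u := by
    have h1 : HasDerivAt (fun v : ℝ ↦ -I * (v : ℂ)) (-I * 1) u :=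
      ((hasDerivAt_id u).ofReal_comp).const_mul (-I)
    rw [mul_one] at h1
    exact h1.cexp
  have hJ0 : HasDerivAt (fun v : ℝ ↦ (besselJ 0 v : ℂ)) (((-besselJ 1 u : ℝ) : ℂ)) u :=
    (hasDerivAt_besselJ_zero_holds u).ofReal_comp
  have hJ1r := hasDerivAt_besselJ_succ_of_ne_zero 0 hu
  simp only [zero_add, Nat.cast_zero, one_mul] at hJ1r
  have hJ1 : HasDerivAt (fun v : ℝ ↦ (besselJ 1 v : ℂ))
      ((((u * besselJ 0 u - besselJ 1 u) / u : ℝ) : ℂ)) u := hJ1r.ofReal_comp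
  have hρ : HasDerivAt (fun v : ℝ ↦ ((v / (2 * (v ^ 2 + 1)) : ℝ) : ℂ)) (((1 - u ^ 2) / (2 * (u ^ 2 + 1) ^ 2) : ℝ) : ℂ) u := (hasDerivAt_rho u).ofReal_comp
  have hρ' : HasDerivAt (fun v : ℝ ↦ (((1 - v ^ 2) / (2 * (v ^ 2 + 1) ^ 2) : ℝ) : ℂ)) ((u * (u ^ 2 - 3) / (u ^ 2 + 1) ^ 3 : ℝ) : ℂ) u := (hasDerivAt_rho' u).ofReal_comp
  have hinv : HasDerivAt (fun v : ℝ ↦ ((v⁻¹ : ℝ) : ℂ)) (((-(u ^ 2)⁻¹ : ℝ)) : ℂ) u :=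
    (hasDerivAt_inv hu).ofReal_comp
  have hP : HasDerivAt (fun v : ℝ ↦ -(((v / (2 * (v ^ 2 + 1)) : ℝ) : ℂ) + I * (((1 - v ^ 2) / (2 * (v ^ 2 + 1) ^ 2) : ℝ) : ℂ))) (-((((1 - u ^ 2) / (2 * (u ^ 2 + 1) ^ 2) : ℝ) : ℂ) + I * ((u * (u ^ 2 - 3) / (u ^ 2 + 1) ^ 3 : ℝ) : ℂ))) u :=
    (hρ.add (hρ'.const_mul I)).neg
  have hQ : HasDerivAt (fun v : ℝ ↦ I * (((v / (2 * (v ^ 2 + 1)) : ℝ) : ℂ) - ((v⁻¹ : ℝ) : ℂ)))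
      (I * ((((1 - u ^ 2) / (2 * (u ^ 2 + 1) ^ 2) : ℝ) : ℂ) - (((-(u ^ 2)⁻¹ : ℝ)) : ℂ))) u := (hρ.sub hinv).const_mul I
  have hB := (hP.mul hJ0).add (hQ.mul hJ1)
  have hW := hE.mul hB
  refine hW.congr_deriv ?_
  simp only [Pi.add_apply, Pi.mul_apply]
  have huC : (u : ℂ) ≠ 0 := by exact_mod_cast hu
  push_cast
  have key := deriv_identity₂ (exp (-I * u)) (u : ℂ) ((u : ℂ) / (2 * ((u : ℂ) ^ 2 + 1)))
    ((1 - (u : ℂ) ^ 2) / (2 * ((u : ℂ) ^ 2 + 1) ^ 2)) ((u : ℂ) * ((u : ℂ) ^ 2 - 3) / ((u : ℂ) ^ 2 + 1) ^ 3)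
    (besselJ 0 u) (besselJ 1 u) huC
  linear_combination key

/-! ### Norm bounds for the three brackets -/

/-- `‖e^{−iu}‖ = 1`. [cite: ConreyIwaniec2002, §4 (4.22)–(4.23)] -/
theorem norm_exp_neg_I_mul (u : ℝ) : ‖exp (-I * u)‖ = 1 := by
  rw [show -I * (u : ℂ) = ((-u : ℝ) : ℂ) * I by push_cast; ring]
  exact Complex.norm_exp_ofReal_mul_I _

/-- `‖a + ib‖ ≤ |a| + |b|` for real `a, b`. [cite: ConreyIwaniec2002, §4 (4.22)–(4.23)] -/
theorem norm_ofReal_add_I_mul_le (a b : ℝ) : ‖(a : ℂ) + I * b‖ ≤ |a| + |b| := by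
  refine (norm_add_le _ _).trans (le_of_eq ?_)
  rw [norm_mul, Complex.norm_I, one_mul, Complex.norm_real, Complex.norm_real,
    Real.norm_eq_abs, Real.norm_eq_abs]

/-- Bound for the bracket of `W`. [cite: ConreyIwaniec2002, §4 (4.22)–(4.23)] -/
theorem norm_bracket₀_le (u : ℝ) :
    ‖(besselJ 0 u : ℂ) + I * (besselJ 1 u : ℂ) -
        I * ((u / (2 * (u ^ 2 + 1)) : ℝ) : ℂ) * (besselJ 0 u : ℂ)‖ ≤
      |besselJ 0 u| + |besselJ 1 u| + 1 / 4 * |besselJ 0 u| := by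
  refine (norm_sub_le _ _).trans (add_le_add ((norm_add_le _ _).trans (le_of_eq ?_)) ?_)
  · rw [norm_mul, Complex.norm_I, one_mul, Complex.norm_real, Complex.norm_real,
      Real.norm_eq_abs, Real.norm_eq_abs]
  · rw [norm_mul, norm_mul, Complex.norm_I, one_mul, Complex.norm_real, Complex.norm_real,
      Real.norm_eq_abs, Real.norm_eq_abs]
    exact mul_le_mul_of_nonneg_right (abs_rho_le_quarter u) (abs_nonneg _)

/-- Bound for the bracket of `W'`. [cite: ConreyIwaniec2002, §4 (4.22)–(4.23)] -/
theorem norm_bracket₁_le {u : ℝ} (hu : 0 < u) :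
    ‖-(((u / (2 * (u ^ 2 + 1)) : ℝ) : ℂ) + I * (((1 - u ^ 2) / (2 * (u ^ 2 + 1) ^ 2) : ℝ) : ℂ)) *
          (besselJ 0 u : ℂ) +
        I * (((u / (2 * (u ^ 2 + 1)) : ℝ) : ℂ) - ((u⁻¹ : ℝ) : ℂ)) * (besselJ 1 u : ℂ)‖ ≤
      (|u / (2 * (u ^ 2 + 1))| + 1 / (2 * (u ^ 2 + 1))) * |besselJ 0 u| + u⁻¹ * |besselJ 1 u| := by
  refine (norm_add_le _ _).trans (add_le_add ?_ ?_)
  · rw [norm_mul, norm_neg, Complex.norm_real, Real.norm_eq_abs]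
    refine mul_le_mul_of_nonneg_right ?_ (abs_nonneg _)
    exact (norm_ofReal_add_I_mul_le _ _).trans (add_le_add le_rfl (abs_rho'_le u))
  · rw [norm_mul, norm_mul, Complex.norm_I, one_mul, ← Complex.ofReal_sub, Complex.norm_real,
      Complex.norm_real, Real.norm_eq_abs, Real.norm_eq_abs]
    exact mul_le_mul_of_nonneg_right (abs_rho_sub_inv_le hu) (abs_nonneg _)

/-- Bound for the bracket of `W''`. [cite: ConreyIwaniec2002, §4 (4.22)–(4.23)] -/
theorem norm_bracket₂_le {u : ℝ} (hu : 0 < u) :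
    ‖(-2 * (((1 - u ^ 2) / (2 * (u ^ 2 + 1) ^ 2) : ℝ) : ℂ) -
            I * ((u * (u ^ 2 - 3) / (u ^ 2 + 1) ^ 3 : ℝ) : ℂ) +
          I * (2 * (((u / (2 * (u ^ 2 + 1))) : ℝ) : ℂ) - ((u⁻¹ : ℝ) : ℂ))) * (besselJ 0 u : ℂ) +
        (2 * (((u / (2 * (u ^ 2 + 1))) : ℝ) : ℂ) - ((u⁻¹ : ℝ) : ℂ) +
          I * (2 * (((1 - u ^ 2) / (2 * (u ^ 2 + 1) ^ 2) : ℝ) : ℂ) + 2 * ((u⁻¹ : ℝ) : ℂ) ^ 2 -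
            (((u / (2 * (u ^ 2 + 1))) : ℝ) : ℂ) * ((u⁻¹ : ℝ) : ℂ))) * (besselJ 1 u : ℂ)‖ ≤
      (1 / (u ^ 2 + 1) + 3 * u / (u ^ 2 + 1) ^ 2 + (u * (u ^ 2 + 1))⁻¹) * |besselJ 0 u| +
        ((u * (u ^ 2 + 1))⁻¹ + (1 / (u ^ 2 + 1) + 2 * u⁻¹ ^ 2 + |u / (2 * (u ^ 2 + 1))| * u⁻¹)) *
          |besselJ 1 u| := by
  have hρ' := abs_rho'_le u
  have hρ'' := abs_rho''_le u hu.le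
  have h2ρ : |2 * (u / (2 * (u ^ 2 + 1))) - u⁻¹| = (u * (u ^ 2 + 1))⁻¹ := by
    rw [two_rho_sub_inv hu.ne', abs_neg, abs_of_pos (by positivity)]
  have h2ρ' : |2 * ((1 - u ^ 2) / (2 * (u ^ 2 + 1) ^ 2))| ≤ 1 / (u ^ 2 + 1) := by
    rw [abs_mul, abs_two]
    have := mul_le_mul_of_nonneg_left hρ' (by norm_num : (0:ℝ) ≤ 2)
    refine this.trans (le_of_eq ?_)
    field_simp
  refine (norm_add_le _ _).trans (add_le_add ?_ ?_)
  · rw [norm_mul, Complex.norm_real, Real.norm_eq_abs (besselJ 0 u)]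
    refine mul_le_mul_of_nonneg_right ?_ (abs_nonneg _)
    have e1 : (-2 * (((1 - u ^ 2) / (2 * (u ^ 2 + 1) ^ 2) : ℝ) : ℂ) -
          I * ((u * (u ^ 2 - 3) / (u ^ 2 + 1) ^ 3 : ℝ) : ℂ) +
        I * (2 * (((u / (2 * (u ^ 2 + 1))) : ℝ) : ℂ) - ((u⁻¹ : ℝ) : ℂ))) =
        ((-(2 * ((1 - u ^ 2) / (2 * (u ^ 2 + 1) ^ 2))) : ℝ) : ℂ) +
          I * ((-(u * (u ^ 2 - 3) / (u ^ 2 + 1) ^ 3) + (2 * (u / (2 * (u ^ 2 + 1))) - u⁻¹) : ℝ) :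
            ℂ) := by
      push_cast; ring
    rw [e1]
    refine (norm_ofReal_add_I_mul_le _ _).trans ?_
    have hb : |(-(u * (u ^ 2 - 3) / (u ^ 2 + 1) ^ 3)) + (2 * (u / (2 * (u ^ 2 + 1))) - u⁻¹)| ≤
        3 * u / (u ^ 2 + 1) ^ 2 + (u * (u ^ 2 + 1))⁻¹ := by
      refine (abs_add_le _ _).trans (add_le_add ?_ (le_of_eq h2ρ))
      rw [abs_neg]; exact hρ''
    have ha : |(-(2 * ((1 - u ^ 2) / (2 * (u ^ 2 + 1) ^ 2))))| ≤ 1 / (u ^ 2 + 1) := by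
      rw [abs_neg]; exact h2ρ'
    linarith
  · rw [norm_mul, Complex.norm_real, Real.norm_eq_abs (besselJ 1 u)]
    refine mul_le_mul_of_nonneg_right ?_ (abs_nonneg _)
    have e2 : (2 * (((u / (2 * (u ^ 2 + 1))) : ℝ) : ℂ) - ((u⁻¹ : ℝ) : ℂ) +
        I * (2 * (((1 - u ^ 2) / (2 * (u ^ 2 + 1) ^ 2) : ℝ) : ℂ) + 2 * ((u⁻¹ : ℝ) : ℂ) ^ 2 -
          (((u / (2 * (u ^ 2 + 1))) : ℝ) : ℂ) * ((u⁻¹ : ℝ) : ℂ))) =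
        (((2 * (u / (2 * (u ^ 2 + 1))) - u⁻¹) : ℝ) : ℂ) +
          I * ((2 * ((1 - u ^ 2) / (2 * (u ^ 2 + 1) ^ 2)) + 2 * u⁻¹ ^ 2 -
            (u / (2 * (u ^ 2 + 1))) * u⁻¹ : ℝ) : ℂ) := by
      push_cast; ring
    rw [e2]
    refine (norm_ofReal_add_I_mul_le _ _).trans (add_le_add (le_of_eq h2ρ) ?_)
    refine (abs_sub _ _).trans (add_le_add ((abs_add_le _ _).trans (add_le_add h2ρ' ?_)) ?_)
    · rw [abs_mul, abs_two, abs_pow, abs_inv, abs_of_pos hu]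
    · rw [abs_mul, abs_inv, abs_of_pos hu]

end BesselAmplitude

end ConreyIwaniec2002

end Literature.NumberTheory.LFunctions

end
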